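import Literature.MathematicalPhysics.QuantumFieldTheory.CentralTwistPolymerExpansion
import HarnessLib

/-!
# Twist locality in the strong-coupling expansion for a plaquette weight on a compact group with a central involution:
# `z^{(𝒱)}(X) = z(X)` for polymers with fewer than `L²` plaquettes

Topic `Literature/MathematicalPhysics/QuantumFieldTheory`; vocabulary of `CentralTwistPolymers.lean` (namespace `CentralTwist`:
`mulLinks z E` — the change of variables `U_b ↦ z U_b` on the links of `E`, `evenPart`, `oddPart`, `twistActivity`,
`twistPolymerActivity`), `VortexTwistCohomology.lean` (`coboundary`, `flipCount`), `CharacterActionPolymers.lean` (`sheetAt`,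
`linkRel`) and `CharacterExpansionTwistLocality.lean` (the group-independent combinatorics: `sq_le_card_of_odd_inter_sheetAt` — a
plaquette set meeting every coboundary evenly and a sheet oddly has at least `L²` plaquettes). THEOREMS ONLY (no definition, no
fact): the file `PlaquetteWeightTwistLocality.lean` (`G = SU(2)`, `z = -𝟙`) redone for an arbitrary compact group `G` and a
CENTRAL element `z` with `z * z = 1` (E. T. Tomboulis, arXiv:0707.2179 [Tomboulis2007Confinement] §6.2, text after (6.9): "This
replacement does not affect polymers that are wholly contained in a simply connected part of `Λ` since, in this case, the flux
can be removed by a change of variables … Only clusters that contain at least one non-simply connected polymer forming a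
topologically non-trivially closed surface can be affected"; K. R. Ito, E. Seiler, arXiv:0803.3019 [ItoSeiler2008Further] Remark
2.1 (3) for `U(1)`: "`U_ω(p) = -U(p)` for `ω = π`").

* `prod_twistActivity_eq_sum_sectors` — `∏_{p∈X} (w^{(V)}(U_p) - 1) = Σ_{Q⊆X} (-1)^{|Q∩V|} ∏_{Q} w_- ∏_{X∖Q} (w_+ - 1)`;
* `twistSectorIntegrand_mulLinks`, `integral_twistSector_eq_zero_of_odd` — the support rule: a sector meeting some
  coboundary oddly integrates to zero (Haar invariance of `U_b ↦ z U_b`, `w_-` odd and `w_+` even under `z`);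
* `twistPolymerActivity_sheetAt_eq_of_card_lt`, `twistPolymerActivity_vortexSheet_eq_of_card_lt` — twist locality.

HONEST FRAMING: finite-volume identities; nothing about large `β` or any limit.
-/

noncomputable section

open MeasureTheory Finset
open scoped BigOperators
open Literature.MathematicalPhysics.QuantumLattice
open Literature.Probability.LatticeModels (IsRConnected GeomInc Touches)

namespace Literature.MathematicalPhysics.QuantumFieldTheory

namespace CentralTwist

open Tomboulis2007

variable {d L : ℕ} {G : Type*} [Group G]

/-! ## Generic group and weight — twist locality -/

section TwistLocality

open Literature.Probability.LatticeModels

/-- `∏_{p∈Q} (± 1) = (-1)^{|Q ∩ V|}` (plumbing). [folklore] -/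
private theorem prod_sign_eq_pow' (V Q : Finset (Plaquette d L)) :
    ∏ p ∈ Q, (if p ∈ V then (-1 : ℝ) else 1) = (-1 : ℝ) ^ (Q ∩ V).card := by
  rw [Finset.prod_ite, Finset.prod_const_one, mul_one, Finset.prod_const, Finset.filter_mem_eq_inter]

/-- **Sector expansion of the polymer integrand**:
`∏_{p∈X} (w^{(V)}(U_p) - 1) = Σ_{Q⊆X} (-1)^{|Q∩V|} ∏_{p∈Q} w_-(U_p) ∏_{p∈X∖Q} (w_+(U_p) - 1)`.
[cite: Tomboulis2007Confinement, App. A §5 eq. (A.17)] -/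
theorem prod_twistActivity_eq_sum_sectors (z : G) (w : G → ℝ) (V X : Finset (Plaquette d L)) (U : GaugeConfig d L G) :
    ∏ p ∈ X, twistActivity z w V U p =
      ∑ Q ∈ X.powerset, (-1 : ℝ) ^ (Q ∩ V).card *
        ((∏ p ∈ Q, oddPart z w (plaquetteHolonomy U p.1 p.2.1.1 p.2.1.2)) *
          ∏ p ∈ X \ Q, (evenPart z w (plaquetteHolonomy U p.1 p.2.1.1 p.2.1.2) - 1)) := by
  simp_rw [twistActivity_eq_evenPart_add_sign_mul_oddPart z w V U]
  rw [Finset.prod_add]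
  refine Finset.sum_congr rfl fun Q _ => ?_
  rw [Finset.prod_mul_distrib, prod_sign_eq_pow']
  ring

variable [NeZero L]

/-- **Multiplying the links of `E` by `z` signs the sector integrand by `(-1)^{|Q ∩ δE|}`** (`w_-` is `z`-odd, `w_+`
`z`-even; `z` central, `z² = 1`). [cite: Tomboulis2007Confinement, §6.2 (text after eq. (6.9))] -/
theorem twistSectorIntegrand_mulLinks {z : G} (hzc : ∀ g : G, z * g = g * z) (hz2 : z * z = 1) (w : G → ℝ)
    (E : Finset (Edge d L)) (X Q : Finset (Plaquette d L)) (U : GaugeConfig d L G) :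
    (∏ p ∈ Q, oddPart z w (plaquetteHolonomy (mulLinks z E U) p.1 p.2.1.1 p.2.1.2)) *
        ∏ p ∈ X \ Q, (evenPart z w (plaquetteHolonomy (mulLinks z E U) p.1 p.2.1.1 p.2.1.2) - 1) =
      (-1 : ℝ) ^ (Q ∩ coboundary E).card *
        ((∏ p ∈ Q, oddPart z w (plaquetteHolonomy U p.1 p.2.1.1 p.2.1.2)) *
          ∏ p ∈ X \ Q, (evenPart z w (plaquetteHolonomy U p.1 p.2.1.1 p.2.1.2) - 1)) := by
  have hH : ∀ p ∈ Q, oddPart z w (plaquetteHolonomy (mulLinks z E U) p.1 p.2.1.1 p.2.1.2) =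
      (if p ∈ coboundary E then (-1 : ℝ) else 1) * oddPart z w (plaquetteHolonomy U p.1 p.2.1.1 p.2.1.2) := by
    intro p _
    rw [plaquetteHolonomy_mulLinks hzc hz2, oddPart_pow_mul hz2]
    by_cases h : p ∈ coboundary E
    · rw [if_pos h, ((mem_coboundary E p).mp h).neg_one_pow]
    · rw [if_neg h, (Nat.not_odd_iff_even.mp (fun h' => h ((mem_coboundary E p).mpr h'))).neg_one_pow]
  have hI : ∀ p ∈ X \ Q, evenPart z w (plaquetteHolonomy (mulLinks z E U) p.1 p.2.1.1 p.2.1.2) - 1 =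
      evenPart z w (plaquetteHolonomy U p.1 p.2.1.1 p.2.1.2) - 1 := by
    intro p _
    rw [plaquetteHolonomy_mulLinks hzc hz2, evenPart_pow_mul hz2]
  rw [Finset.prod_congr rfl hH, Finset.prod_congr rfl hI, Finset.prod_mul_distrib, prod_sign_eq_pow']
  ring

section Haar

variable [TopologicalSpace G] [IsTopologicalGroup G] [CompactSpace G] [MeasurableSpace G] [BorelSpace G]

/-- **Support rule**: a sector `Q` meeting some coboundary oddly integrates to zero (the change of variables
`U_b ↦ z U_b` on `E` preserves Haar measure and flips the sign of the integrand).
[cite: Tomboulis2007Confinement, §6.2 (text after eq. (6.9))] -/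
theorem integral_twistSector_eq_zero_of_odd {z : G} (hzc : ∀ g : G, z * g = g * z) (hz2 : z * z = 1) (w : G → ℝ)
    {E : Finset (Edge d L)} {X Q : Finset (Plaquette d L)} (hodd : Odd (Q ∩ coboundary E).card) :
    ∫ U, (∏ p ∈ Q, oddPart z w (plaquetteHolonomy U p.1 p.2.1.1 p.2.1.2)) *
        ∏ p ∈ X \ Q, (evenPart z w (plaquetteHolonomy U p.1 p.2.1.1 p.2.1.2) - 1)
      ∂(Measure.pi fun _ : Edge d L => haarProbability G) = 0 := by
  have key : ∀ F : GaugeConfig d L G → ℝ, (∀ U, F (mulLinks z E U) = -1 * F U) →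
      ∫ U, F U ∂(Measure.pi fun _ : Edge d L => haarProbability G) = 0 := by
    intro F hF
    let e : GaugeConfig d L G ≃ᵐ GaugeConfig d L G :=
      { toFun := mulLinks z E
        invFun := mulLinks z E
        left_inv := mulLinks_mulLinks hz2 E
        right_inv := mulLinks_mulLinks hz2 E
        measurable_toFun := (measurePreserving_mulLinks z E).measurable
        measurable_invFun := (measurePreserving_mulLinks z E).measurable }
    have hmp : MeasurePreserving e
        (Measure.pi fun _ : Edge d L => haarProbability G)
        (Measure.pi fun _ : Edge d L => haarProbability G) :=
      measurePreserving_mulLinks z E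
    have h1 : ∫ U, F U ∂(Measure.pi fun _ : Edge d L => haarProbability G) =
        -1 * ∫ U, F U ∂(Measure.pi fun _ : Edge d L => haarProbability G) := by
      calc ∫ U, F U ∂(Measure.pi fun _ : Edge d L => haarProbability G)
          = ∫ U, F (e U) ∂(Measure.pi fun _ : Edge d L => haarProbability G) :=
            (hmp.integral_comp' F).symm
        _ = ∫ U, -1 * F U ∂(Measure.pi fun _ : Edge d L => haarProbability G) := by
            congr 1
            funext U
            exact hF U
        _ = -1 * ∫ U, F U ∂(Measure.pi fun _ : Edge d L => haarProbability G) := integral_const_mul _ _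
    linarith
  refine key _ fun U => ?_
  rw [twistSectorIntegrand_mulLinks hzc hz2 w E X Q U, hodd.neg_one_pow]

/-- Contrapositive: a sector with non-zero integral meets every coboundary evenly.
[cite: Tomboulis2007Confinement, §6.2 (text after eq. (6.9))] -/
theorem even_inter_coboundary_of_integral_twistSector_ne_zero {z : G} (hzc : ∀ g : G, z * g = g * z)
    (hz2 : z * z = 1) (w : G → ℝ) {X Q : Finset (Plaquette d L)}
    (hne : ∫ U, (∏ p ∈ Q, oddPart z w (plaquetteHolonomy U p.1 p.2.1.1 p.2.1.2)) *
        ∏ p ∈ X \ Q, (evenPart z w (plaquetteHolonomy U p.1 p.2.1.1 p.2.1.2) - 1)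
      ∂(Measure.pi fun _ : Edge d L => haarProbability G) ≠ 0)
    (E : Finset (Edge d L)) : Even (Q ∩ coboundary E).card := by
  by_contra h
  exact hne (integral_twistSector_eq_zero_of_odd hzc hz2 w (Nat.not_even_iff_odd.mp h))

variable [SecondCountableTopology G]

omit [CompactSpace G] [NeZero L] in
/-- Plaquette holonomies are measurable (plumbing). [folklore] -/
private theorem measurable_hol' (p : Plaquette d L) :
    Measurable fun U : GaugeConfig d L G => plaquetteHolonomy U p.1 p.2.1.1 p.2.1.2 := by
  unfold plaquetteHolonomy
  fun_prop

omit [TopologicalSpace G] [IsTopologicalGroup G] [CompactSpace G] [MeasurableSpace G] [BorelSpace G]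
  [SecondCountableTopology G] [NeZero L] in
/-- `|w_-(W)| ≤ ε` when `sup|w - 1| ≤ ε` (plumbing). [folklore] -/
private theorem abs_oddPart_le (z : G) {w : G → ℝ} {ε : ℝ} (hε : ∀ W, |w W - 1| ≤ ε) (W : G) :
    |oddPart z w W| ≤ ε := by
  unfold oddPart
  have h1 := hε W
  have h2 := hε (z * W)
  rw [abs_le] at h1 h2 ⊢
  constructor <;> linarith [h1.1, h1.2, h2.1, h2.2]

omit [TopologicalSpace G] [IsTopologicalGroup G] [CompactSpace G] [MeasurableSpace G] [BorelSpace G]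
  [SecondCountableTopology G] [NeZero L] in
/-- `|w_+(W) - 1| ≤ ε` when `sup|w - 1| ≤ ε` (plumbing). [folklore] -/
private theorem abs_evenPart_sub_one_le (z : G) {w : G → ℝ} {ε : ℝ} (hε : ∀ W, |w W - 1| ≤ ε) (W : G) :
    |evenPart z w W - 1| ≤ ε := by
  unfold evenPart
  have h1 := hε W
  have h2 := hε (z * W)
  rw [abs_le] at h1 h2 ⊢
  constructor <;> linarith [h1.1, h1.2, h2.1, h2.2]

/-- Integrability of the sector integrands (bounded measurable; plumbing). [folklore] -/
private theorem integrable_twistSector (z : G) {w : G → ℝ} (hw : Measurable w) {ε : ℝ} (hε : ∀ W, |w W - 1| ≤ ε)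
    (X Q : Finset (Plaquette d L)) :
    Integrable (fun U : GaugeConfig d L G =>
        (∏ p ∈ Q, oddPart z w (plaquetteHolonomy U p.1 p.2.1.1 p.2.1.2)) *
          ∏ p ∈ X \ Q, (evenPart z w (plaquetteHolonomy U p.1 p.2.1.1 p.2.1.2) - 1))
      (Measure.pi fun _ : Edge d L => haarProbability G) := by
  have hmO : Measurable (oddPart z w) := by
    unfold oddPart
    exact (hw.sub (hw.comp (measurable_id.const_mul z))).div_const 2
  have hmE : Measurable (evenPart z w) := by
    unfold evenPart
    exact (hw.add (hw.comp (measurable_id.const_mul z))).div_const 2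
  have hm : Measurable fun U : GaugeConfig d L G =>
      (∏ p ∈ Q, oddPart z w (plaquetteHolonomy U p.1 p.2.1.1 p.2.1.2)) *
        ∏ p ∈ X \ Q, (evenPart z w (plaquetteHolonomy U p.1 p.2.1.1 p.2.1.2) - 1) :=
    (Finset.measurable_prod _ fun p _ => hmO.comp (measurable_hol' p)).mul
      (Finset.measurable_prod _ fun p _ => (hmE.comp (measurable_hol' p)).sub measurable_const)
  refine Integrable.of_mem_Icc (-(ε ^ Q.card * ε ^ (X \ Q).card)) (ε ^ Q.card * ε ^ (X \ Q).card) hm.aemeasurable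
    (ae_of_all _ fun U => Set.mem_Icc.2 (abs_le.1 ?_))
  rw [abs_mul, Finset.abs_prod, Finset.abs_prod]
  refine mul_le_mul ?_ ?_ (Finset.prod_nonneg fun p _ => abs_nonneg _) (pow_nonneg ((abs_nonneg _).trans (hε 1)) _)
  · rw [← Finset.prod_const]
    exact Finset.prod_le_prod (fun p _ => abs_nonneg _) fun p _ => abs_oddPart_le z hε _
  · rw [← Finset.prod_const]
    exact Finset.prod_le_prod (fun p _ => abs_nonneg _) fun p _ => abs_evenPart_sub_one_le z hε _

/-- **The integral of the polymer integrand as a signed sum of sector integrals.**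
[cite: Tomboulis2007Confinement, App. A §5 eqs. (A.17)–(A.18)] -/
theorem integral_prod_twistActivity_eq_sum_sectors (z : G) {w : G → ℝ} (hw : Measurable w) {ε : ℝ}
    (hε : ∀ W, |w W - 1| ≤ ε) (V X : Finset (Plaquette d L)) :
    ∫ U, ∏ p ∈ X, twistActivity z w V U p ∂(Measure.pi fun _ : Edge d L => haarProbability G) =
      ∑ Q ∈ X.powerset, (-1 : ℝ) ^ (Q ∩ V).card *
        ∫ U, (∏ p ∈ Q, oddPart z w (plaquetteHolonomy U p.1 p.2.1.1 p.2.1.2)) *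
          ∏ p ∈ X \ Q, (evenPart z w (plaquetteHolonomy U p.1 p.2.1.1 p.2.1.2) - 1)
          ∂(Measure.pi fun _ : Edge d L => haarProbability G) := by
  simp_rw [prod_twistActivity_eq_sum_sectors z w V X]
  rw [integral_finsetSum _ (fun Q _ => (integrable_twistSector z hw hε X Q).const_mul _)]
  refine Finset.sum_congr rfl fun Q _ => ?_
  rw [integral_const_mul]

/-- **Twist locality** (any compact group, central involution `z`, weight near `1`): for every plaquette set `X` with
fewer than `L²` plaquettes and every parallel sheet `𝒱_{a,b}`, `z^{(𝒱_{a,b})}(X) = z(X)` (arXiv:0707.2179 §6.2 after (6.9)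
and (6.11): only polymers "forming a topologically non-trivially closed surface can be affected").
[cite: Tomboulis2007Confinement, §6.2 eqs. (6.10)–(6.11)] -/
theorem twistPolymerActivity_sheetAt_eq_of_card_lt {z : G} (hzc : ∀ g : G, z * g = g * z) (hz2 : z * z = 1)
    {w : G → ℝ} (hw : Measurable w) {ε : ℝ} (hε : ∀ W, |w W - 1| ≤ ε) {i j : Fin d} (hij : i < j) (a b : ZMod L)
    {X : Finset (Plaquette d L)} (hX : X.card < L ^ 2) :
    twistPolymerActivity z w (sheetAt L a b i j hij) X = twistPolymerActivity z w ∅ X := by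
  by_cases hconn : IsRConnected linkRel X
  · rw [twistPolymerActivity_of_isRConnected z hconn, twistPolymerActivity_of_isRConnected z hconn,
      integral_prod_twistActivity_eq_sum_sectors z hw hε, integral_prod_twistActivity_eq_sum_sectors z hw hε]
    congr 1
    refine Finset.sum_congr rfl fun Q hQ => ?_
    rw [Finset.inter_empty, Finset.card_empty, pow_zero]
    by_cases hzero : ∫ U, (∏ p ∈ Q, oddPart z w (plaquetteHolonomy U p.1 p.2.1.1 p.2.1.2)) *
        ∏ p ∈ X \ Q, (evenPart z w (plaquetteHolonomy U p.1 p.2.1.1 p.2.1.2) - 1)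
        ∂(Measure.pi fun _ : Edge d L => haarProbability G) = 0
    · rw [hzero, mul_zero, mul_zero]
    · have hcyc := even_inter_coboundary_of_integral_twistSector_ne_zero hzc hz2 w hzero
      have heven : Even (Q ∩ sheetAt L a b i j hij).card := by
        by_contra hodd
        have hL := sq_le_card_of_odd_inter_sheetAt hcyc hij (Nat.not_even_iff_odd.mp hodd)
        have hQX : Q.card ≤ X.card := Finset.card_le_card (Finset.mem_powerset.1 hQ)
        omega
      rw [heven.neg_one_pow]
  · rw [twistPolymerActivity_of_not_isRConnected z hconn, twistPolymerActivity_of_not_isRConnected z hconn]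

/-- **Twist locality for the sheet `𝒱_{ij}`**: `z⁻(X) = z(X)` whenever `|X| < L²`.
[cite: Tomboulis2007Confinement, §6.2 eqs. (6.10)–(6.11)] -/
theorem twistPolymerActivity_vortexSheet_eq_of_card_lt {z : G} (hzc : ∀ g : G, z * g = g * z) (hz2 : z * z = 1)
    {w : G → ℝ} (hw : Measurable w) {ε : ℝ} (hε : ∀ W, |w W - 1| ≤ ε) {i j : Fin d} (hij : i < j)
    {X : Finset (Plaquette d L)} (hX : X.card < L ^ 2) :
    twistPolymerActivity z w (vortexSheet L i j hij) X = twistPolymerActivity z w ∅ X := by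
  rw [← sheetAt_zero_zero hij]
  exact twistPolymerActivity_sheetAt_eq_of_card_lt hzc hz2 hw hε hij 0 0 hX

end Haar

end TwistLocality

end CentralTwist

end Literature.MathematicalPhysics.QuantumFieldTheory

end
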